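import Mathlib
import Literature.Topology.FourManifolds.ProfiniteDetectionSumS1S2
import Summits.SmoothPoincare4.SmoothPoincare4.Theses.CongruenceShadows

/-!
# Sketch — crux-ideate, crux `CongruenceShadows.HeegaardPairFreenessDetection` (stmt-SmoothPoincare4-15157), ideator 2, round 1

First lemmas of the two idea cards (they only need to ELABORATE; `sorry` allowed here):

* card `retract-projectivity`  — §1: weak solvability of finite embedding problems passes to
  retracts (PROVED here); the two named-fact SHAPES the line needs (`KneserMilnorRetract`,
  `AsphericalNotFinitelyProjective`) and the composition shape.
* card `schreier-betti-bookkeeping` — §2: the free-factor Hom-count identity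
  `|Hom(U₁,Q)|·|Q|^{n-1} = |Hom(A,Q)|^n` for a finite-index `U₁ ≤ A`, `A` a free factor of a group
  with the finite quotients of `F_k` (statement only), and its two immediate kills.

Notation: "`G` has the finite quotients of `F_k`" is spelled exactly as in the crux.
-/

noncomputable section

open scoped Manifold ContDiff Topology
open Function Subgroup Monoid

namespace Summit.SmoothPoincare4.SmoothPoincare4.Cruxes.HeegaardPairFreenessDetection.SketchIdeator2

open Literature.Topology.FourManifolds

universe u

/-- "`G` has exactly the finite quotients of `F_k`", as spelled in the crux. -/
def HasFiniteQuotientsOfFree (G : Type*) [Group G] (k : ℕ) : Prop :=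
  ∀ (Q : Type) [Group Q] [Finite Q],
    (∃ f : G →* Q, Function.Surjective f) ↔ (∃ f : FreeGroup (Fin k) →* Q, Function.Surjective f)

/-- Every finite embedding problem `(π : G → P, ε : E ↠ P)` for `G` is weakly solvable
("`G` is finitely projective"; Fried–Jarden Def. 22.3.1 read on the discrete group). -/
def FinitelyProjective (G : Type u) [Group G] : Prop :=
  ∀ (P E : Type) [Group P] [Finite P] [Group E] [Finite E] (π : G →* P) (ε : E →* P),
    Function.Surjective ε → ∃ f : G →* E, ε.comp f = π

/-! ## §1  Card `retract-projectivity` -/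

/-- **A group with the finite quotients of a free group is finitely projective** — this is the
tree's `exists_monoidHom_comp_eq_of_sameFiniteQuotients_freeGroup`, repackaged. -/
theorem finitelyProjective_of_hasFiniteQuotientsOfFree {G : Type u} [Group G] {k : ℕ}
    (hQ : HasFiniteQuotientsOfFree G k) : FinitelyProjective G :=
  fun _P _E _ _ _ _ π ε hε => exists_monoidHom_comp_eq_of_sameFiniteQuotients_freeGroup hQ π ε hε

/-- **First lemma of the card (PROVED): finite projectivity passes to retracts.**  If
`r ∘ s = id_A` and every finite embedding problem for `G` is weakly solvable, then so is every
finite embedding problem for `A`: solve `(π ∘ r, ε)` on `G` and precompose with `s`. -/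
theorem finitelyProjective_of_retract {G A : Type u} [Group G] [Group A] (r : G →* A) (s : A →* G)
    (hrs : ∀ a, r (s a) = a) (hG : FinitelyProjective G) : FinitelyProjective A := by
  intro P E _ _ _ _ π ε hε
  obtain ⟨f, hf⟩ := hG P E (π.comp r) ε hε
  refine ⟨f.comp s, MonoidHom.ext fun a => ?_⟩
  have h := DFunLike.congr_fun hf (s a)
  simp only [MonoidHom.comp_apply] at h ⊢
  rw [h, hrs]

/-- Free factors are retracts: the left factor of `A ∗ B` (Mathlib `Monoid.Coprod.fst ∘ inl = id`). -/
theorem finitelyProjective_freeFactor {A B : Type u} [Group A] [Group B]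
    (h : FinitelyProjective (Monoid.Coprod A B)) : FinitelyProjective A :=
  finitelyProjective_of_retract (Monoid.Coprod.fst : Monoid.Coprod A B →* A) Monoid.Coprod.inl
    (fun a => Monoid.Coprod.fst_apply_inl a) h

/-- **A non-trivial FINITE group is not finitely projective** (Fried–Jarden Prop. 22.4.7:
projective profinite groups are torsion-free; finite level: Gaschütz's non-split Frattini
extension `F_d / R'Rᵖ ↠ P`, or the coinduced `ℤ/p² ↠ ℤ/p` via Shapiro).  Statement only. -/
theorem not_finitelyProjective_of_finite {P : Type u} [Group P] [Finite P] [Nontrivial P] :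
    ¬ FinitelyProjective P := by
  sorry

/-- SHAPE of named fact (KMR) "Kneser–Milnor retract dichotomy" (Kneser 1929 / Milnor 1962 prime
decomposition on `π₁`, AFW15 Thm 1.1, + asphericity of irreducible pieces with infinite `π₁`,
AFW15 (C.1) = Sphere Theorem + Hurewicz): the fundamental group of a closed orientable 3-manifold
is free of some rank, or has a free factor (`π₁ ≅ A ∗ H`) which is non-trivial finite or is the
fundamental group of a closed orientable ASPHERICAL 3-manifold. -/
def KneserMilnorRetract : Prop :=
  ∀ (Y : Type u) [TopologicalSpace Y] [T2Space Y] [SecondCountableTopology Y]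
    [ChartedSpace (EuclideanSpace ℝ (Fin 3)) Y] [IsManifold (𝓡 3) ∞ Y] [CompactSpace Y]
    [ConnectedSpace Y] (_ : IsOrientable (𝓡 3) Y) (y : Y),
    (∃ r : ℕ, IsFreeOfRank (FundamentalGroup Y y) r) ∨
    ∃ (A H : Type u) (_ : Group A) (_ : Group H),
      Nonempty (FundamentalGroup Y y ≃* Monoid.Coprod A H) ∧
      ((Finite A ∧ Nontrivial A) ∨
        ∃ (N : Type u) (_ : TopologicalSpace N) (_ : T2Space N) (_ : SecondCountableTopology N)
          (_ : ChartedSpace (EuclideanSpace ℝ (Fin 3)) N) (_ : IsManifold (𝓡 3) ∞ N)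
          (_ : CompactSpace N) (_ : ConnectedSpace N) (_ : IsOrientable (𝓡 3) N) (x : N),
          (∀ n : ℕ, 2 ≤ n → Subsingleton (HomotopyGroup (Fin n) N x)) ∧
          Nonempty (A ≃* FundamentalGroup N x))

/-- SHAPE of named fact (NP) "closed aspherical 3-manifold groups are not finitely projective":
some finite embedding problem `(φ : π₁N ↠ A, α : B ↠ A)` has no weak solution.  In print:
`π₁N` is PD³ and good (Wilton–Zalesskii 2019 Thm 1.9: closed 3-manifold groups are good; Agol,
Wise, WZ2010, GJZ08 inside) ⇒ `π̂₁N` is profinite PD³ at every `p` (WZ19 Thm 1.10 =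
Kochloukova–Zalesskii 2008) ⇒ `cd π̂₁N = 3 > 1` ⇒ `π̂₁N` not projective (Fried–Jarden Rem. 22.4.4 /
Cor. 22.4.3) ⇒ some FINITE embedding problem for `π̂₁N` is not weakly solvable (Gruenberg,
Fried–Jarden Lemma 22.3.2) ⇒ restricted to the dense subgroup `π₁N` it has no weak solution
(universal property of the completion). -/
def AsphericalNotFinitelyProjective : Prop :=
  ∀ (N : Type u) [TopologicalSpace N] [T2Space N] [SecondCountableTopology N]
    [ChartedSpace (EuclideanSpace ℝ (Fin 3)) N] [IsManifold (𝓡 3) ∞ N] [CompactSpace N]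
    [ConnectedSpace N] (_ : IsOrientable (𝓡 3) N) (x : N),
    (∀ n : ℕ, 2 ≤ n → Subsingleton (HomotopyGroup (Fin n) N x)) →
    ¬ FinitelyProjective (FundamentalGroup N x)

/-- **Composition shape of the line** (the WZ19 named fact replaced by KMR + NP): a closed
orientable 3-manifold group with the finite quotients of `F_k` is free of rank `k`.
Proof plan: it is finitely projective (tree); by KMR either free of some rank — then rank
detection `IsFreeOfRank.of_sameFiniteQuotients` (tree) — or it has a free factor `A` that is
finitely projective (`finitelyProjective_freeFactor`, transported along the iso) yet finite
non-trivial (`not_finitelyProjective_of_finite`) or aspherical (NP): contradiction. -/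
theorem isFreeOfRank_fundamentalGroup_of_parts (hKM : KneserMilnorRetract.{u})
    (hNP : AsphericalNotFinitelyProjective.{u}) :
    isFreeOfRank_fundamentalGroup_of_sameFiniteQuotients.{u} := by
  intro k Y _ _ _ _ _ _ _ hY y hQ
  -- the 3-manifold group is finitely projective (tree lemma)
  have hproj : FinitelyProjective (FundamentalGroup Y y) :=
    finitelyProjective_of_hasFiniteQuotientsOfFree hQ
  rcases hKM Y hY y with ⟨r, hr⟩ | ⟨A, H, _, _, ⟨e⟩, hA⟩
  · -- free of some rank: rank detection (tree)
    exact hr.of_sameFiniteQuotients hQ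
  · -- a free factor `A` is a retract of `π₁(Y) ≅ A ∗ H`, hence finitely projective
    have hAproj : FinitelyProjective A := by
      refine finitelyProjective_of_retract
        ((Monoid.Coprod.fst : Monoid.Coprod A H →* A).comp e.toMonoidHom)
        (e.symm.toMonoidHom.comp Monoid.Coprod.inl) (fun a => ?_) hproj
      simp
    exfalso
    rcases hA with ⟨hfin, hnt⟩ | ⟨N, _, _, _, _, _, _, _, hN, x, hasph, ⟨eN⟩⟩
    · haveI := hfin; haveI := hnt
      exact not_finitelyProjective_of_finite hAproj
    · -- transport along `A ≃* π₁(N)` (an isomorphism is a retract) and apply (NP)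
      refine hNP N hN x hasph ?_
      exact finitelyProjective_of_retract eN.toMonoidHom eN.symm.toMonoidHom
        (fun a => eN.apply_symm_apply a) hAproj

/-- … and then the crux itself, via the landed Jaco–Hempel fact and the tree's corollary. -/
theorem crux_of_parts (hKM : KneserMilnorRetract.{0}) (hNP : AsphericalNotFinitelyProjective.{0})
    (hJH : exists_closedThreeManifold_fundamentalGroup_pairQuotient.{0}) :
    Summit.SmoothPoincare4.SmoothPoincare4.Theses.CongruenceShadows.HeegaardPairFreenessDetection :=
  fun g k K₁ K₂ h₁ h₂ hQ =>
    isFreeOfRank_pairQuotient_of_sameFiniteQuotients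
      (isFreeOfRank_fundamentalGroup_of_parts hKM hNP) hJH g k K₁ K₂ h₁ h₂ hQ

/-! ## §2  Card `schreier-betti-bookkeeping` -/

/-- **First lemma of the card (statement): the free-factor Hom-count identity.**  If `A ∗ B` has
the finite quotients of `F_k` and `U ≤ A` has finite index `n`, then for every finite group `Q`
`|Hom(U, Q)| · |Q|^(n-1) = |Hom(A, Q)|^n`.
Proof plan (all finite combinatorics): (E1) for ANY group and its coset action `α` on `n`
points with stabiliser `U`, the homomorphisms to the wreath product `Q ≀ Sₙ` lying over `α` number
`|Hom(U,Q)|·|Q|^(n-1)` (induction; brute-force checked, exp/wreath_count.py); (E2) the tree's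
DFPR isomorphism `G ⧸ R_E(G) ≅ F_k ⧸ R_E(F_k)` for `E = Q ≀ Sₙ` transports Hom-sets compatibly with
`E → Sₙ`, so that count equals the free-group count `|Q|^(nk)`; (E3) the universal property of
`A ∗ B` splits the count as `(|Hom(U,Q)|·|Q|^(n-1)) · |Hom(B,Q)|^n`, and
`|Hom(A,Q)|·|Hom(B,Q)| = |Q|^k` (tree: `card_monoidHom_eq_of_sameFiniteQuotients_freeGroup`). -/
theorem card_hom_subgroup_freeFactor {A B : Type} [Group A] [Group B] {k : ℕ}
    (hQ : HasFiniteQuotientsOfFree (Monoid.Coprod A B) k) (U : Subgroup A) [U.FiniteIndex]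
    (Q : Type) [Group Q] [Finite Q] :
    Nat.card (U →* Q) * Nat.card Q ^ (U.index - 1) = Nat.card (A →* Q) ^ U.index := by
  sorry

/-- Kill 1 (finite factors), from the identity with `U = ⊥`, `Q = ℤ/2`:
`2^(|A|-1) = |Hom(A, ℤ/2)|^|A|` is impossible for `|A| ≥ 2` (exponent `|A|-1` is not a multiple
of `|A|`).  Statement only. -/
theorem subsingleton_of_finite_freeFactor {A B : Type} [Group A] [Finite A] [Group B] {k : ℕ}
    (hQ : HasFiniteQuotientsOfFree (Monoid.Coprod A B) k) : Subsingleton A := by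
  sorry

/-- Kill 2 (perfect factors are profinitely invisible): a free factor `A` with
`Hom(A, ℤ/2) = 1` (e.g. `H₁(A) = 0`) has NO proper finite-index subgroup — with `Q = ℤ/2` the
identity reads `|Hom(U,ℤ/2)| · 2^(n-1) = 1`.  Against (RFA) "aspherical closed 3-manifold groups
are residually finite" this excludes aspherical factors with `b₁ = 0`.  Statement only. -/
theorem index_eq_one_of_perfect_freeFactor {A B : Type} [Group A] [Group B] {k : ℕ}
    (hQ : HasFiniteQuotientsOfFree (Monoid.Coprod A B) k)
    (hA : ∀ f : A →* Multiplicative (ZMod 2), f = 1) (U : Subgroup A) [U.FiniteIndex] :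
    U.index = 1 := by
  sorry

end Summit.SmoothPoincare4.SmoothPoincare4.Cruxes.HeegaardPairFreenessDetection.SketchIdeator2

end
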